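import Summits.ValiantsHypothesis.ValiantsHypothesis.Theses.TwistedDetRank
import Literature.Computability.AlgebraicComplexity.SyntacticMultilinear

/-!
# Skeleton `birth` for crux `TwistedDetRank.SliceVPInVBP` (stmt-ValiantsHypothesis-17992; X2a of the
# VBP redirect of `FermionicNormalForm`) — VP ⊆ smVP ⊆ VBP on the class-function GMF slice

X2a ("a p-computable class-function GMF family has affine determinantal representations of
p-bounded size") is a COLLAPSE statement (graded `VP → VBP` on the slice).  The slice's defining
syntactic feature is that every GMF `f_χ = Σ_σ χ(σ) Π_i X_{σ(i),i}` is MULTILINEAR (indeed one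
variable per row and per column), so the natural architecture of a collapse proof is
multilinearisation followed by linearisation into a skew (= determinantal, Toda / Malod–Portier)
computation:

* `stub_smCollapse` (MULTILINEARISATION AT POLYNOMIAL COST on the slice): a p-computable
  class-function GMF family has fan-in-2 SYNTACTICALLY MULTILINEAR circuits (Raz–Yehudayoff 2008 §2;
  tree `smCircuitSize`) of p-bounded size.  General multilinearisation costs `2^{O(deg)}`; the bet is
  that class symmetry + permutation support make it polynomial.  OPEN even for `det` (no polynomial
  syntactically multilinear circuit for `det_n` is known — Raz–Yehudayoff 2008, Intro.; none is
  excluded either: the record lower bound for sm-circuits is `Ω(n^{4/3}/log² n)`,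
  Raz–Shpilka–Yehudayoff 2008), VH-free (no explicit family is known to need superpolynomial
  sm-circuits, so the stub is consistent with `VP = VNP`).
* `stub_smToDetRepr` (LINEARISATION: `smVP ⊆ VBP` on the slice): a class-function GMF family with
  p-bounded syntactically multilinear circuit size has affine determinantal representations of
  p-bounded size.  Known: sm-circuits of size `s` balance to sm depth `O(log s · log n)` and to
  sm-FORMULAS of size `n^{O(log n)}` (Raz–Yehudayoff 2008 Thm 1.1), whence `dc ≤ n^{O(log n)}`
  (Valiant 1979); the polynomial statement is open (sm-ABPs ⊋ sm-formulas, Dvir–Malod–Perifel–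
  Yehudayoff 2012, but sm-circuits vs ABPs is unresolved), VH-free for the same reason.
* composition `SliceVPInVBP_of` (kernel-checked).

Neither stub is the crux or the summit: `stub_smCollapse` concludes an sm-size bound, not `dc`;
`stub_smToDetRepr` assumes one; both are consistent with `VP ℂ = VNP ℂ`.
-/

noncomputable section

namespace Summit.ValiantsHypothesis.ValiantsHypothesis.Cruxes.SliceVPInVBP.Birth

open Literature.Computability.AlgebraicComplexity
open Summit.ValiantsHypothesis.ValiantsHypothesis.Theses.TwistedDetRank

/-- STUB (multilinearisation at polynomial cost on the class-function slice): a p-computable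
class-function GMF family has syntactically multilinear fan-in-2 circuits of p-bounded size
(`smCircuitSize`, Raz–Yehudayoff 2008 §2). [open; RazYehudayoff2008, Burgisser2000] -/
theorem stub_smCollapse :
    ∀ χ : (n : ℕ) → Equiv.Perm (Fin n) → ℂ,
      (∀ (n : ℕ) (σ τ : Equiv.Perm (Fin n)), χ n (τ * σ * τ⁻¹) = χ n σ) →
      IsPComputable (fun n => ∑ σ : Equiv.Perm (Fin n),
        MvPolynomial.C (χ n σ) * ∏ i : Fin n, (MvPolynomial.X (σ i, i) : MvPolynomial (Fin n × Fin n) ℂ)) →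
      ∃ c : ℕ, ∀ n : ℕ, smCircuitSize (∑ σ : Equiv.Perm (Fin n),
        MvPolynomial.C (χ n σ) * ∏ i : Fin n, (MvPolynomial.X (σ i, i) : MvPolynomial (Fin n × Fin n) ℂ)) ≤
        ((n ^ c + c : ℕ) : ℕ∞) := by
  sorry

/-- STUB (`smVP ⊆ VBP` on the class-function slice): a class-function GMF family with p-bounded
syntactically multilinear circuit size has affine determinantal representations of p-bounded size.
[open; RazYehudayoff2008 Thm 1.1 gives only `n^{O(log n)}`, MalodPortier2008, Valiant1979] -/
theorem stub_smToDetRepr :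
    ∀ χ : (n : ℕ) → Equiv.Perm (Fin n) → ℂ,
      (∀ (n : ℕ) (σ τ : Equiv.Perm (Fin n)), χ n (τ * σ * τ⁻¹) = χ n σ) →
      (∃ c : ℕ, ∀ n : ℕ, smCircuitSize (∑ σ : Equiv.Perm (Fin n),
        MvPolynomial.C (χ n σ) * ∏ i : Fin n, (MvPolynomial.X (σ i, i) : MvPolynomial (Fin n × Fin n) ℂ)) ≤
        ((n ^ c + c : ℕ) : ℕ∞)) →
      ∃ c : ℕ, ∀ n : ℕ, ∃ m ≤ n ^ c + c,
        HasDetRepr (∑ σ : Equiv.Perm (Fin n),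
          MvPolynomial.C (χ n σ) * ∏ i : Fin n, (MvPolynomial.X (σ i, i) : MvPolynomial (Fin n × Fin n) ℂ)) m := by
  sorry

/-- COMPOSITION: the two stubs give the crux `SliceVPInVBP` (by name). [this skeleton] -/
theorem SliceVPInVBP_of : SliceVPInVBP :=
  fun χ hχ hc => stub_smToDetRepr χ hχ (stub_smCollapse χ hχ hc)

end Summit.ValiantsHypothesis.ValiantsHypothesis.Cruxes.SliceVPInVBP.Birth

end
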